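import Mathlib.CategoryTheory.SingleObj
import Mathlib.CategoryTheory.PUnit
import Literature.AlgebraicGeometry.Frobenioids.BaseCategoryTheoreticity
import HarnessLib

/-!
# Frobenioids I, Theorem 3.4 (i) (preservation part): the universal closure of the typed per-instance
# schema over the BARE operations interface is FALSE

Mochizuki, *The geometry of Frobenioids I: the general theory*, Kyushu J. Math. **62** (2008)
293–400, Thm. 3.4 (i) p. 62 [cite: MochizukiFrdI2008, Thm. 3.4 (i) p.62]:

> "(i) If `C₁`, `C₂` are of quasi-isotropic type, then `Ψ` preserves the isotropic objects, isotropic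
> hulls and isometric pre-steps."

PROOF-ONLY companion (no definitions, no instances) of `BaseCategoryTheoreticity.lean` (seat
abc-iut-f-018, float row of its own trunk: FACT-LIST F-0900 `PreFrobenioidData.Thm34i`, kernel_closedness
`parametrised`). The declaration is a conclusion predicate in the operations `S_i : PreFrobenioidData C_i D_i`
of Def. 1.1 (iv) (NOT the Frobenioid axioms of Def. 1.3) and an arbitrary equivalence `Ψ`; the paper
asserts it for Frobenioids, where it is PROVED in the tree — `FrdI.Thm34i_holds`
(`BaseCategoryTheoreticityProofs.lean`, F-0710; cited, not restated). This file records that its UNIVERSAL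
CLOSURE over the bare interface (level `0`) is false.

THE JUNK MODEL. On `B(N_{≥1})` the typed quasi-isotropy forces every object to be isotropic (no
anchors), so the preservation clauses hold there; the counterexample lives on the ANCHORED one-object
category `B(ℕ × ℕ) = SingleObj (ℕ × ℕ)` (written multiplicatively): its irreducible arrows are `(1,0)` and
`(0,1)` only, so the object is an anchor, hence (identity quotient by the trivial group) an iso-subanchor,
and the typed quasi-isotropy holds as soon as the object is NOT isotropic. Take base `Discrete PUnit`
(constant), `deg_Fr ≡ 1`, `Φ ≡ ℕ` with identity pull-backs, and `Div =` the SECOND coordinate for `S₁`,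
the FIRST coordinate for `S₂` (`exists_ops₂`): the isometric pre-steps are the arrows `(a, 0)`, resp.
`(0, b)`; both objects are non-isotropic; and `Ψ = 𝟭` does not carry the isometric pre-step `(1,0)` of
`S₁` to an isometric pre-step of `S₂`. A refuted closure is a statement about the typing, not about the
paper; no statement of the paper is restated or strengthened; no side is taken on [IUTchIII] Cor. 3.12.
-/

namespace Literature.AlgebraicGeometry.Frobenioids

open CategoryTheory

namespace PreFrobenioidData

namespace SchemaNegativeThm34i

/-! ### The anchored one-object category `B(ℕ × ℕ)` -/

/-- In `ℕ × ℕ` (multiplicative notation) `a * b = 1` forces `b = 1`. [folklore] -/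
private theorem eq_one_of_mul_eq_one₂ {a b : Multiplicative (ℕ × ℕ)} (h : a * b = 1) : b = 1 := by
  have h' : Multiplicative.toAdd a + Multiplicative.toAdd b = 0 := by
    rw [← toAdd_mul, h, toAdd_one]
  have h1 : (Multiplicative.toAdd a).1 + (Multiplicative.toAdd b).1 = 0 := by
    simpa using congrArg Prod.fst h'
  have h2 : (Multiplicative.toAdd a).2 + (Multiplicative.toAdd b).2 = 0 := by
    simpa using congrArg Prod.snd h'
  have hb : Multiplicative.toAdd b = (0, 0) :=
    Prod.ext (Nat.eq_zero_of_add_eq_zero_left h1) (Nat.eq_zero_of_add_eq_zero_left h2)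
  exact (ofAdd_toAdd b).symm.trans (congrArg Multiplicative.ofAdd hb)

/-- In `B(ℕ × ℕ)` an invertible arrow is `(0,0)`. [folklore] -/
private theorem eq_one_of_isIso₂ {x y : SingleObj (Multiplicative (ℕ × ℕ))} (φ : x ⟶ y) [IsIso φ] :
    φ = (1 : Multiplicative (ℕ × ℕ)) :=
  eq_one_of_mul_eq_one₂ (a := inv φ) (b := φ) (IsIso.hom_inv_id φ)

/-- In `B(ℕ × ℕ)` the arrow `(0,0)` is invertible. [folklore] -/
private theorem isIso_of_eq_one₂ {x y : SingleObj (Multiplicative (ℕ × ℕ))} (φ : x ⟶ y)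
    (h : φ = (1 : Multiplicative (ℕ × ℕ))) : IsIso φ := by
  cases x
  cases y
  subst h
  exact IsIso.id _

/-- Multiplication in `Multiplicative (ℕ × ℕ)` is addition of pairs. [folklore] -/
private theorem ofAdd_mul_ofAdd (p q : ℕ × ℕ) :
    Multiplicative.ofAdd p * Multiplicative.ofAdd q = Multiplicative.ofAdd (p + q) := (ofAdd_add p q).symm

/-- The irreducible arrows of `B(ℕ × ℕ)` (FrdI §0 p. 17: not invertible, every factorisation has an
invertible factor) are `(1,0)` and `(0,1)`. [cite: MochizukiFrdI2008, §0 p.17] -/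
theorem eq_of_isIrreducibleHom {x y : SingleObj (Multiplicative (ℕ × ℕ))} (φ : x ⟶ y)
    (hφ : IsIrreducibleHom φ) :
    φ = Multiplicative.ofAdd ((1, 0) : ℕ × ℕ) ∨ φ = Multiplicative.ofAdd ((0, 1) : ℕ × ℕ) := by
  obtain ⟨hni, hfac⟩ := hφ
  have key : ∀ u v : Multiplicative (ℕ × ℕ), u * v = φ → u = 1 ∨ v = 1 := by
    intro u v huv
    rcases hfac (X := x) v u huv with h | h
    · exact Or.inl (@eq_one_of_isIso₂ x y u h)
    · exact Or.inr (@eq_one_of_isIso₂ x x v h)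
  have hne : φ ≠ (1 : Multiplicative (ℕ × ℕ)) := fun h => hni (isIso_of_eq_one₂ φ h)
  obtain ⟨a, b⟩ := φ
  rcases Nat.eq_zero_or_pos a with ha | ha
  · subst ha
    have hb : 1 ≤ b := by
      rcases Nat.eq_zero_or_pos b with hb | hb
      · subst hb
        exact (hne rfl).elim
      · exact hb
    rcases key (Multiplicative.ofAdd ((0, 1) : ℕ × ℕ)) (Multiplicative.ofAdd ((0, b - 1) : ℕ × ℕ))
        (by rw [ofAdd_mul_ofAdd]; exact congrArg Multiplicative.ofAdd
              (Prod.ext rfl (Nat.add_sub_cancel' hb))) with h | h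
    · exact absurd h (by decide)
    · have h' : b - 1 = 0 := by simpa using congrArg (fun t => (Multiplicative.toAdd t).2) h
      have hb1 : b = 1 := by omega
      subst hb1
      exact Or.inr rfl
  · rcases key (Multiplicative.ofAdd ((1, 0) : ℕ × ℕ)) (Multiplicative.ofAdd ((a - 1, b) : ℕ × ℕ))
        (by rw [ofAdd_mul_ofAdd]; exact congrArg Multiplicative.ofAdd
              (Prod.ext (Nat.add_sub_cancel' ha) (zero_add b))) with h | h
    · exact absurd h (by decide)
    · have h1 : a - 1 = 0 := by simpa using congrArg (fun t => (Multiplicative.toAdd t).1) h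
      have h2 : b = 0 := by simpa using congrArg (fun t => (Multiplicative.toAdd t).2) h
      have ha1 : a = 1 := by omega
      subst ha1
      subst h2
      exact Or.inl rfl

/-- Hence the object of `B(ℕ × ℕ)` is an anchor: the isomorphism classes of irreducible arrows out of it
are among those of `(1,0)` and `(0,1)`. [cite: MochizukiFrdI2008, §0 p.18] -/
theorem isAnchor (A : SingleObj (Multiplicative (ℕ × ℕ))) : IsAnchor A := by
  cases A
  have hfin : Set.Finite ({Quotient.mk (isIsomorphicSetoid (Under (SingleObj.star (Multiplicative (ℕ × ℕ)))))
        (Under.mk (Y := SingleObj.star _) (Multiplicative.ofAdd ((1, 0) : ℕ × ℕ))),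
      Quotient.mk (isIsomorphicSetoid (Under (SingleObj.star (Multiplicative (ℕ × ℕ)))))
        (Under.mk (Y := SingleObj.star _) (Multiplicative.ofAdd ((0, 1) : ℕ × ℕ)))} :
      Set (Quotient (isIsomorphicSetoid (Under (SingleObj.star (Multiplicative (ℕ × ℕ))))))) :=
    (Set.finite_singleton _).insert _
  refine hfin.subset ?_
  rintro _ ⟨f, hf, rfl⟩
  obtain ⟨⟨⟨⟩⟩, ⟨⟩, g⟩ := f
  rcases eq_of_isIrreducibleHom g hf with h | h
  · subst h
    exact Set.mem_insert _ _
  · subst h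
    exact Set.mem_insert_of_mem _ (Set.mem_singleton _)

/-- … and an iso-subanchor (the identity is a mono-minimal categorical quotient of the anchor by the
trivial group). [cite: MochizukiFrdI2008, §0 p.18] -/
theorem isIsoSubanchor (A : SingleObj (Multiplicative (ℕ × ℕ))) : IsIsoSubanchor A := by
  refine ⟨A, ⊥, 𝟙 A, ⟨A, isAnchor A, ⟨𝟙 A⟩⟩, ⟨?_, ?_⟩, ?_⟩
  · intro γ hγ
    rw [Subgroup.mem_bot] at hγ
    subst hγ
    exact Category.comp_id _
  · intro X ψ _
    exact ⟨ψ, Category.id_comp ψ, fun ψ' h => ((Category.id_comp ψ').symm.trans h)⟩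
  · intro A' ζ φ' hζ _ _
    exact isIso_of_eq_one₂ ζ (eq_one_of_mul_eq_one₂ (a := φ') (b := ζ) hζ)

/-! ### Junk operations on `B(ℕ × ℕ)` with a prescribed divisor map -/

/-- Junk operations on `B(ℕ × ℕ)` EXIST: base constant at the point of `Discrete PUnit`, `Φ ≡ ℕ` with
identity pull-backs, `deg_Fr ≡ 1`, `Div = d` for a homomorphism `d : ℕ × ℕ → ℕ`; the isometric pre-steps
are exactly the arrows in the kernel of `d`. NOT the operations of any Frobenioid; a counterexample carrier
only. [cite: MochizukiFrdI2008, Def. 1.1 (iv) p.20] -/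
theorem exists_ops₂ (d : Multiplicative (ℕ × ℕ) →* Multiplicative ℕ) :
    ∃ S : PreFrobenioidData.{0} (SingleObj (Multiplicative (ℕ × ℕ))) (Discrete PUnit.{1}),
      ∀ {x y : SingleObj (Multiplicative (ℕ × ℕ))} (φ : x ⟶ y), S.IsIsometricPreStep φ ↔ d φ = 1 := by
  refine ⟨{ base := (Functor.const _).obj ⟨⟨⟩⟩
            Mon := fun _ => Multiplicative ℕ
            pull := fun _ => MonoidHom.id _
            pull_id := fun _ _ => rfl
            pull_comp := fun _ _ _ => rfl
            div := fun φ => d φ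
            degFr := fun _ => 1
            div_id := fun _ => map_one d
            div_comp := fun ψ φ => ?_
            degFr_id := fun _ => rfl
            degFr_comp := fun _ _ => (mul_one 1).symm }, fun φ => ?_⟩
  · rw [SingleObj.comp_as_mul, map_mul, MonoidHom.id_apply, PNat.one_coe, pow_one]
  · exact ⟨fun h => h.2, fun h => ⟨⟨rfl, by change IsIso (𝟙 _); infer_instance⟩, h⟩⟩

/-- Such operations are of quasi-isotropic type as soon as some non-identity arrow is an isometric
pre-step (the object is then non-isotropic, and it is an iso-subanchor).
[cite: MochizukiFrdI2008, Def. 3.1 (i) p.56] -/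
theorem isOfQuasiIsotropicType₂
    (S : PreFrobenioidData.{0} (SingleObj (Multiplicative (ℕ × ℕ))) (Discrete PUnit.{1}))
    (φ₀ : SingleObj.star (Multiplicative (ℕ × ℕ)) ⟶ SingleObj.star (Multiplicative (ℕ × ℕ)))
    (h₀ : S.IsIsometricPreStep φ₀) (hne : φ₀ ≠ (1 : Multiplicative (ℕ × ℕ))) :
    S.IsOfQuasiIsotropicType :=
  ⟨fun A => by
    cases A
    exact ⟨fun _ => isIsoSubanchor _, fun _ hiso => hne (@eq_one_of_isIso₂ _ _ φ₀ (hiso φ₀ h₀))⟩⟩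

end SchemaNegativeThm34i

open SchemaNegativeThm34i

/-! ### The refutation -/

/-- **The universal closure of the typed `PreFrobenioidData.Thm34i` is false** (F-0900): on the anchored
carrier `B(ℕ × ℕ)` over `Discrete PUnit` (`deg_Fr ≡ 1`, `Φ ≡ ℕ`), with `Div` the second coordinate for
`S₁` and the first coordinate for `S₂` (both of quasi-isotropic type: non-isotropic iso-subanchor) and
`Ψ = 𝟭`, the isometric pre-step `(1,0)` of `S₁` is not an isometric pre-step of `S₂`. The INSTANCE FORM
over Frobenioids is the closed fact `FrdI.Thm34i_holds` (F-0710). [cite: MochizukiFrdI2008, Thm. 3.4 (i) p.62] -/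
theorem not_forall_thm34i :
    ¬ ∀ {C₁ : Type} [Category.{0} C₁] {D₁ : Type} [Category.{0} D₁]
        {C₂ : Type} [Category.{0} C₂] {D₂ : Type} [Category.{0} D₂]
        (S₁ : PreFrobenioidData.{0} C₁ D₁) (S₂ : PreFrobenioidData.{0} C₂ D₂) (Ψ : C₁ ≌ C₂),
        S₁.Thm34i S₂ Ψ := by
  intro h
  obtain ⟨S₁, h₁⟩ := exists_ops₂ (AddMonoidHom.toMultiplicative (AddMonoidHom.snd ℕ ℕ))
  obtain ⟨S₂, h₂⟩ := exists_ops₂ (AddMonoidHom.toMultiplicative (AddMonoidHom.fst ℕ ℕ))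
  have e₁ := (h₁ (x := SingleObj.star (Multiplicative (ℕ × ℕ))) (y := SingleObj.star (Multiplicative (ℕ × ℕ)))
    (Multiplicative.ofAdd ((1, 0) : ℕ × ℕ))).2 rfl
  have e₂ := (h₂ (x := SingleObj.star (Multiplicative (ℕ × ℕ))) (y := SingleObj.star (Multiplicative (ℕ × ℕ)))
    (Multiplicative.ofAdd ((0, 1) : ℕ × ℕ))).2 rfl
  obtain ⟨-, -, hP⟩ := h S₁ S₂ CategoryTheory.Equivalence.refl
    (isOfQuasiIsotropicType₂ S₁ _ e₁
      (fun h => absurd (congrArg (fun t => (Multiplicative.toAdd t).1) h) (by simp)))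
    (isOfQuasiIsotropicType₂ S₂ _ e₂
      (fun h => absurd (congrArg (fun t => (Multiplicative.toAdd t).2) h) (by simp)))
  have hP' : ∀ ⦃A B : SingleObj (Multiplicative (ℕ × ℕ))⦄ (φ : A ⟶ B), S₁.IsIsometricPreStep φ →
      S₂.IsIsometricPreStep
        ((CategoryTheory.Equivalence.refl (C := SingleObj (Multiplicative (ℕ × ℕ)))).functor.map φ) := hP
  have h3 := (h₂ _).1 (hP' (A := SingleObj.star _) (B := SingleObj.star _)
    (Multiplicative.ofAdd ((1, 0) : ℕ × ℕ)) e₁)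
  have h4 : ((1, 0) : ℕ × ℕ).1 = (0 : ℕ) := congrArg Multiplicative.toAdd h3
  simp at h4

end PreFrobenioidData

end Literature.AlgebraicGeometry.Frobenioids
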